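import Mathlib
import Summits.ResolutionOfSingularities.ResolutionOfSingularities.Theorems.WeightedInvariantContactFiltrationEssSmoothLevels
import Summits.ResolutionOfSingularities.ResolutionOfSingularities.Theorems.WeightedInvariantContactCentreFiltrationRegular
import Summits.ResolutionOfSingularities.ResolutionOfSingularities.Theorems.WeightedInvariantEssSmoothDimensionLETwo
import Summits.ResolutionOfSingularities.ResolutionOfSingularities.Theorems.WeightedInvariantHypersurfaceLocalGameEFT4SDimLETwo
import Summits.ResolutionOfSingularities.ResolutionOfSingularities.Theorems.WeightedInvariantIotaOrderEssSmooth
import HarnessLib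

/-!
# (c11)↾≤2 for `(iotaOrd, jContact)`: the centre filtration extends along essentially smooth local homomorphisms

Topic: `Summits/ResolutionOfSingularities/ResolutionOfSingularities/Theorems`. Helper for the door item
`HypersurfaceCentreConstruction` (statement `stmt-ResolutionOfSingularities-19897`, route `WeightedInvariant`),
line `local-engine` of `res-L1-w43-plan-1` (L W4.3), ORDER (o24) rung P2, piece **(o24-C)**: the conjunct
`IotaJEssSmoothCompatibleLE2 iotaOrd jContact` of `P2Rung p iotaOrd jContact` (`…EFT4SDimLETwo`, p512950) — for every
local, formally smooth, essentially-of-finite-type homomorphism `φ : S → S'` of regular local rings with `dim S' ≤ 2`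
and every `f ∈ S`: `iotaOrd S' (φ f) = iotaOrd S f` (p503771) and
`jContact S' (φ f) m = (jContact S f m) S'` for all `m` (`jContact` of `…ContactCentreFiltration`, p514802).

Proof of the `J`-half by the branches of `jContactLocal`: `f = 0 ↦ ⊥`, units `↦ ⊤` (uniform junk, design note (R4));
monomial type ascends (`…EssSmoothMonomialTypeDescent`, p517017) and `√(v g^ν) S' = (φ g) = √(φ f)`; off the monomial
type `dim S = dim S' = 2` and `𝔪 S' = 𝔪'` (`…EssSmoothDimensionLETwo`, p519712), monomial type is reflected
(p517017), `ord` and `bMax` agree (`…ContactFiltrationEssSmoothLevels`, p518970), and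
the supremum over the maximisers of `S'` equals the extension of the supremum over the maximisers of `S` by the
canonicity of the contact filtration (C2 `contactFiltration_eq_of_mem`, p511384) at `bMax ≥ 2` and by
`F_{g,b}(m) = 𝔪^m` at `bMax ≤ 1`.

[OURS · L1 W4.3] Replaces the role of NO printed item; NOT a statement of the manuscript
[claim: Hironaka2017, status: under-review]. AI work, weaker than expert review.

## References

* H. Hironaka, *Characteristic polyhedra of singularities*, J. Math. Kyoto Univ. 7 (1967) 251–293. [Hironaka1967]
* H. Matsumura, *Commutative Ring Theory*, Thm. 15.1, §22–§23. [Matsumura1987]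
-/

noncomputable section

open IsLocalRing Literature.AlgebraicGeometry.Resolution

set_option linter.dupNamespace false -- mandated namespace of this single-conjunct summit

namespace Summit.ResolutionOfSingularities.ResolutionOfSingularities.Theorems

namespace EssSmoothCentre

open Summit.ResolutionOfSingularities.ResolutionOfSingularities.Cruxes.HypersurfaceCentreConstruction.LocalEngine
open Summit.ResolutionOfSingularities.ResolutionOfSingularities.Cruxes.HypersurfaceCentreConstruction.LocalEngine
  (IotaOrderEssSmooth.mem_maximalIdeal_pow_iff_of_formallySmooth IotaOrderEssSmooth.adicOrder_algebraMap_eq_of_formallySmooth)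
open IotaOrderEssSmooth (mem_maximalIdeal_pow_iff_of_formallySmooth adicOrder_algebraMap_eq_of_formallySmooth)

variable {S S' : Type} [CommRing S] [CommRing S'] [IsRegularLocalRing S] [IsRegularLocalRing S'] [Algebra S S']
  [IsLocalHom (algebraMap S S')] [Algebra.FormallySmooth S S'] [Algebra.EssFiniteType S S']

/-! ## §1. The monomial branch -/

/-- `√(φ f) = √(f) S'` at a non-unit `f = v g^ν` of monomial type: both are `(g)` extended (`radical_span_unit_mul_pow`,
p516684). [folklore] -/
theorem radical_span_map_of_isMonomialType {f : S} (hfu : ¬ IsUnit f) (hm : IsMonomialType f) :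
    (Ideal.span {algebraMap S S' f}).radical = ((Ideal.span {f}).radical).map (algebraMap S S') := by
  obtain ⟨v, g, ν, hv, hg, hg2, rfl⟩ := hm
  have hν : 1 ≤ ν := by
    rcases Nat.eq_zero_or_pos ν with h | h
    · exact absurd (by rw [h, pow_zero, mul_one]; exact hv) hfu
    · exact h
  rw [radical_span_unit_mul_pow hv hg hg2 hν, map_mul, map_pow,
    radical_span_unit_mul_pow (hv.map _) (map_nonunit _ _ hg)
      (fun h => hg2 ((mem_maximalIdeal_pow_iff_of_formallySmooth S S' 2 g).mpr h)) hν,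
    Ideal.map_span, Set.image_singleton]

/-! ## §2. The contact branch -/

/-- **The contact branch extends** (`dim S = dim S' = 2`, `𝔪 S' = 𝔪'`, `f ∈ 𝔪 ∖ 0` not of monomial type):
`jContactLocal (φ f) m = (jContactLocal f m) S'`. [cite: Hironaka1967, Thm. (well-preparedness)] -/
theorem jContactLocal_map_of_not_isMonomialType (h𝔪 : (maximalIdeal S).map (algebraMap S S') = maximalIdeal S')
    (hS : ringKrullDim S = (2 : ℕ)) (hS' : ringKrullDim S' = (2 : ℕ)) {f : S} (hf0 : f ≠ 0) (hfu : ¬ IsUnit f)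
    (hnm : ¬ IsMonomialType f) (m : ℕ) :
    jContactLocal (algebraMap S S' f) m = (jContactLocal f m).map (algebraMap S S') := by
  classical
  have hfm : f ∈ maximalIdeal S := (IsLocalRing.mem_maximalIdeal f).mpr hfu
  have hf0' : algebraMap S S' f ≠ 0 := fun h =>
    hf0 (EssSmoothDescent.algebraMap_injective (S := S) (S' := S') (by rw [h, map_zero]))
  have hfu' : ¬ IsUnit (algebraMap S S' f) := fun h => hfu ((isUnit_map_iff _ f).mp h)
  have hnm' : ¬ IsMonomialType (algebraMap S S' f) := fun h =>
    hnm (EssSmoothDescent.isMonomialType_of_map h𝔪 hS hS' h)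
  obtain ⟨hν, -, hford⟩ := EssSmoothLevels.adicOrder_toNat_spec hf0 hfm
  set ν := (adicOrder f).toNat with hνdef
  have hford' : algebraMap S S' f ∉ maximalIdeal S' ^ (ν + 1) := fun h =>
    hford ((mem_maximalIdeal_pow_iff_of_formallySmooth S S' _ f).mpr h)
  rw [jContactLocal_of_not_isMonomialType hf0' hfu' hnm', jContactLocal_of_not_isMonomialType hf0 hfu hnm,
    adicOrder_algebraMap_eq_of_formallySmooth S S' f, EssSmoothLevels.bMax_map_eq h𝔪 hS hS' hf0 hfm, ← hνdef]
  set B := bMax f with hBdef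
  rw [Ideal.map_sup, Ideal.map_pow, h𝔪, Ideal.map_iSup]
  simp_rw [Ideal.map_iSup, EssSmoothLevels.map_contactFiltration h𝔪]
  refine le_antisymm (sup_le le_sup_left (iSup₂_le fun g' hg' => ?_)) (sup_le le_sup_left (iSup₂_le fun g hg => ?_))
  · -- a maximiser `g'` of `S'`
    obtain ⟨hg'm, hg'2, hg'f⟩ := hg'
    rcases Nat.lt_or_ge B 2 with hB | hB
    · rcases (show B = 0 ∨ B = 1 by omega) with hB0 | hB1
      · rw [hB0, contactFiltration_zero_weight]
        exact le_sup_left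
      · rw [hB1, contactFiltration_one_weight hg'm]
        exact le_sup_left
    · -- `B ≥ 2`: a maximiser of `S` exists, and C2 identifies the two filtrations in `S'`
      have hmem : B ∈ {b : ℕ | 1 ≤ b ∧ Reaches f ν b} := by
        have hB' : sSup {b : ℕ | 1 ≤ b ∧ Reaches f ν b} = B := by rw [hBdef, bMax_def]
        have hne : {b : ℕ | 1 ≤ b ∧ Reaches f ν b}.Nonempty := by
          by_contra h
          rw [Set.not_nonempty_iff_eq_empty] at h
          rw [h, csSup_empty] at hB'
          exact absurd hB' (by change ¬ (0 = B); omega)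
        have hbdd : BddAbove {b : ℕ | 1 ≤ b ∧ Reaches f ν b} := by
          by_contra h
          rw [csSup_of_not_bddAbove h, csSup_empty] at hB'
          exact absurd hB' (by change ¬ (0 = B); omega)
        rw [← hB']
        exact Nat.sSup_mem hne hbdd
      obtain ⟨-, g₀, hg₀, hg₀2, hfg₀⟩ := hmem
      have hφg₀ : algebraMap S S' g₀ ∈ maximalIdeal S' := map_nonunit _ _ hg₀
      have hφg₀2 : algebraMap S S' g₀ ∉ maximalIdeal S' ^ 2 := fun h =>
        hg₀2 ((mem_maximalIdeal_pow_iff_of_formallySmooth S S' 2 g₀).mpr h)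
      have hφf : algebraMap S S' f ∈ contactFiltration (algebraMap S S' g₀) B (B * ν) :=
        (EssSmoothLevels.algebraMap_mem_contactFiltration_iff h𝔪 f g₀ B _).mpr hfg₀
      have heq : contactFiltration g' B m = contactFiltration (algebraMap S S' g₀) B m :=
        ContactFiltration.contactFiltration_eq_of_mem hg'm hg'2 hφg₀ hφg₀2 hB hν hford' hg'f hφf m
      rw [heq]
      exact le_sup_of_le_right (le_iSup₂_of_le g₀ ⟨hg₀, hg₀2, hfg₀⟩ le_rfl)
  · -- a maximiser `g` of `S` extends to a maximiser `φ g` of `S'`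
    obtain ⟨hgm, hg2, hgf⟩ := hg
    exact le_sup_of_le_right (le_iSup₂_of_le (algebraMap S S' g)
      ⟨map_nonunit _ _ hgm, fun h => hg2 ((mem_maximalIdeal_pow_iff_of_formallySmooth S S' 2 g).mpr h),
        (EssSmoothLevels.algebraMap_mem_contactFiltration_iff h𝔪 f g B _).mpr hgf⟩ le_rfl)

/-! ## §3. The clause -/

/-- **The `J`-half of (c11)↾≤2 for `jContact`**: `jContact S' (φ f) m = (jContact S f m) S'` along a local, formally smooth,
essentially-of-finite-type homomorphism of regular local rings with `dim S' ≤ 2`. [OURS · L1 W4.3 · rung P2] -/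
theorem jContact_map (hdim' : ringKrullDim S' ≤ 2) (f : S) (m : ℕ) :
    jContact S' (algebraMap S S' f) m = (jContact S f m).map (algebraMap S S') := by
  rw [jContact_eq, jContact_eq]
  by_cases hf0 : f = 0
  · subst hf0
    rw [map_zero, jContactLocal_zero, jContactLocal_zero, Ideal.map_bot]
  by_cases hfu : IsUnit f
  · rw [jContactLocal_of_isUnit hfu, jContactLocal_of_isUnit (hfu.map _), Ideal.map_top]
  have hf0' : algebraMap S S' f ≠ 0 := fun h =>
    hf0 (EssSmoothDescent.algebraMap_injective (S := S) (S' := S') (by rw [h, map_zero]))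
  have hfu' : ¬ IsUnit (algebraMap S S' f) := fun h => hfu ((isUnit_map_iff _ f).mp h)
  by_cases hm : IsMonomialType f
  · rw [jContactLocal_of_isMonomialType hf0' hfu' (EssSmoothDescent.isMonomialType_map hm),
      jContactLocal_of_isMonomialType hf0 hfu hm, Ideal.map_pow, radical_span_map_of_isMonomialType hfu hm]
  · -- dimension two on both sides and `𝔪 S' = 𝔪'` (p519712)
    obtain ⟨hS, hS', h𝔪⟩ := EssSmoothLE2.dims_of_not_isMonomialType S S' hdim' hf0 hfu hm
    exact jContactLocal_map_of_not_isMonomialType h𝔪 hS hS' hf0 hfu hm m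

/-- **(o24-C) — THE CLAUSE (c11)↾≤2 FOR `(iotaOrd, jContact)`**: along every local, formally smooth,
essentially-of-finite-type homomorphism `S → S'` of regular local rings with `dim S' ≤ 2`, `iotaOrd` is preserved and
`jContact` extends — the conjunct `IotaJEssSmoothCompatibleLE2 iotaOrd jContact` of the P2 rung
`P2Rung p iotaOrd jContact` (p512950), unconditionally and for every `p`. [OURS · L1 W4.3 · rung P2] -/
theorem iotaJEssSmoothCompatibleLE2_iotaOrd_jContact : IotaJEssSmoothCompatibleLE2 iotaOrd jContact := by
  intro S S' _ _ _ _ _ _ _ _ f hdim'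
  exact ⟨iotaOrd_essSmooth_eq S S' f, fun m => jContact_map hdim' f m⟩

end EssSmoothCentre

end Summit.ResolutionOfSingularities.ResolutionOfSingularities.Theorems

end
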